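import Summits.CriticalPhenomena.PercolationContinuityZ3.Theorems.PercNearOneGluingNoHeavyLowerTailSahiThreeCopyMarginal
import Summits.CriticalPhenomena.PercolationContinuityZ3.Theorems.PercNearOneGluingNoHeavyLowerTailSahiThreeCopyCubeFour
import Summits.CriticalPhenomena.PercolationContinuityZ3.Theorems.PercNearOneGluingNoHeavyLowerTailSahiThreeCopyBernstein

/-!
# `NoHeavyLowerTail` (crux stmt-CriticalPhenomena-4575), Sahi programme: **3C-SAHI (hence Kahn's inequality) FOR EVERY TRIPLE IN
# WHICH TWO OF THE FUNCTIONS DEPEND ON AT MOST FOUR COMMON COORDINATES, THE THIRD ARBITRARY** — in every dimension, at every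
# profile and under every product measure

Support file (Sahi cell, seat `prim-sahi-p1`, generation 55; `--supports stmt-CriticalPhenomena-4575`).  COMPUTATIONAL through
`…SahiThreeCopyCubeFour` (`checkCube_four`, `native_decide`, generation 1).
* `tc_liftB_nonneg_of_le_four` — for `d ≤ 4`, nonnegative monotone `f, g : {0,1}^d → ℝ` and ANY nonnegative monotone
  `h : {0,1}^{d+m} → ℝ`: `0 ≤ c_B(liftB f, liftB g, h)` at every profile `B` (localisation `tc_liftB` + `tc_nonneg_of_le_four`);
  `tc_liftB_nonneg_of_le_three` the kernel-`decide` part (`d ≤ 3`).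
* `sahiE_three_coin_liftB_nonneg_of_le_four` — law level: `E₃^{coin q}(liftB f, liftB g, h) ≥ 0` for every `q ∈ [0,1]^{d+m}`
  (Kahn's Conjecture 5 for all increasing `A, B, C ⊆ {0,1}^n` such that `A` and `B` are determined by four common coordinates).
The two fixed slots may be any two (symmetry of `c_b`) and the four coordinates anywhere (`…SubstitutionCorollaries.tc_reindex`).
Examples now settled in every dimension `n`: `(x₁∨x₂, x₂∨x₃, h)`, `(x₁x₂∨x₃x₄, x₁x₃∨x₂x₄, h)`, `(Maj₃, x₁∨x₄, h)` with `h` any monotone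
function of `x₁,…,x_n` — none of these is nested, principal, block-independent or read-once in general.  With the census's exhaustive
`d = 5` (CENSUS §190) the same holds at evidence level for five common coordinates.  [this work]
-/

namespace Summit.CriticalPhenomena.PercolationContinuityZ3.Theorems.SahiThreeCopy

open Finset Function Literature.Combinatorics.Sahi2008
open scoped BigOperators

noncomputable section

variable {d : ℕ}

/-- ★★ **3C-SAHI when two slots live on `≤ 4` common coordinates**: for `d ≤ 4`, nonnegative monotone `f, g : {0,1}^d → ℝ` (lifted to
`{0,1}^{d+m}`) and ANY nonnegative monotone `h : {0,1}^{d+m} → ℝ`, `0 ≤ c_B(liftB f, liftB g, h)` at every profile `B`. [this work] -/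
theorem tc_liftB_nonneg_of_le_four (hd : d ≤ 4) (m : ℕ) {f g : Pt d → ℝ} (hf : ∀ x, 0 ≤ f x) (hfm : Monotone f)
    (hg : ∀ x, 0 ≤ g x) (hgm : Monotone g) {h : Pt (d + m) → ℝ} (hh : ∀ w, 0 ≤ h w) (hhm : Monotone h)
    (B : Fin (d + m) → ℕ) : 0 ≤ tc B (liftB m f) (liftB m g) h :=
  tc_liftB_nonneg_of_dim m (fun b' _ _ _ hu hv hw hum hvm hwm => tc_nonneg_of_le_four hd b' hu hv hw hum hvm hwm) hf hfm hg hgm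
    hh hhm B

/-- The kernel-`decide` part: the same for `d ≤ 3` without `native_decide`. [this work] -/
theorem tc_liftB_nonneg_of_le_three (hd : d ≤ 3) (m : ℕ) {f g : Pt d → ℝ} (hf : ∀ x, 0 ≤ f x) (hfm : Monotone f)
    (hg : ∀ x, 0 ≤ g x) (hgm : Monotone g) {h : Pt (d + m) → ℝ} (hh : ∀ w, 0 ≤ h w) (hhm : Monotone h)
    (B : Fin (d + m) → ℕ) : 0 ≤ tc B (liftB m f) (liftB m g) h := by
  refine tc_liftB_nonneg_of_dim m (fun b' u v w hu hv hw hum hvm hwm => ?_) hf hfm hg hgm hh hhm B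
  refine tc_nonneg_of_forall_setInd_left b' v w hu hum fun U hU => ?_
  rw [tc_comm12]
  refine tc_nonneg_of_forall_setInd_left b' (setInd U) w hv hvm fun V hV => ?_
  rw [tc_comm23, tc_comm12]
  refine tc_nonneg_of_forall_setInd_left b' (setInd V) (setInd U) hw hwm fun W hW => ?_
  exact tc_setInd_nonneg_of_le_three hd b' hW hV hU

/-- The slot carrying the free function may be any of the three: here slots 1 and 3 lifted, slot 2 free. [this work] -/
theorem tc_liftB_nonneg_of_le_four₁₃ (hd : d ≤ 4) (m : ℕ) {f h : Pt d → ℝ} (hf : ∀ x, 0 ≤ f x) (hfm : Monotone f)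
    (hh : ∀ x, 0 ≤ h x) (hhm : Monotone h) {g : Pt (d + m) → ℝ} (hg : ∀ w, 0 ≤ g w) (hgm : Monotone g)
    (B : Fin (d + m) → ℕ) : 0 ≤ tc B (liftB m f) g (liftB m h) := by
  rw [tc_comm23]
  exact tc_liftB_nonneg_of_le_four hd m hf hfm hh hhm hg hgm B

/-- Slots 2 and 3 lifted, slot 1 free. [this work] -/
theorem tc_liftB_nonneg_of_le_four₂₃ (hd : d ≤ 4) (m : ℕ) {g h : Pt d → ℝ} (hg : ∀ x, 0 ≤ g x) (hgm : Monotone g)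
    (hh : ∀ x, 0 ≤ h x) (hhm : Monotone h) {f : Pt (d + m) → ℝ} (hf : ∀ w, 0 ≤ f w) (hfm : Monotone f)
    (B : Fin (d + m) → ℕ) : 0 ≤ tc B f (liftB m g) (liftB m h) := by
  rw [tc_comm12, tc_comm23]
  exact tc_liftB_nonneg_of_le_four hd m hg hgm hh hhm hf hfm B

/-- **Law level (Kahn's Conjecture 5 for this class)**: under every product measure on `{0,1}^{d+m}`, `d ≤ 4`,
`E₃^{coin q}(liftB f, liftB g, h) ≥ 0` for nonnegative monotone `f, g` on `{0,1}^d` and any nonnegative monotone `h`. [this work] -/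
theorem sahiE_three_coin_liftB_nonneg_of_le_four (hd : d ≤ 4) (m : ℕ) {q : Fin (d + m) → ℝ} (hq : ∀ i, 0 ≤ q i ∧ q i ≤ 1)
    {f g : Pt d → ℝ} (hf : ∀ x, 0 ≤ f x) (hfm : Monotone f) (hg : ∀ x, 0 ≤ g x) (hgm : Monotone g) {h : Pt (d + m) → ℝ}
    (hh : ∀ w, 0 ≤ h w) (hhm : Monotone h) : 0 ≤ sahiE (coinWeight q) 3 ![liftB m f, liftB m g, h] :=
  sahiE_three_coin_nonneg_of_tc hq fun B => tc_liftB_nonneg_of_le_four hd m hf hfm hg hgm hh hhm B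

end

end Summit.CriticalPhenomena.PercolationContinuityZ3.Theorems.SahiThreeCopy
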